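import Summits.ValiantsHypothesis.ValiantsHypothesis.Theorems.DepthWindowSparseTwoLevel
import Mathlib.RingTheory.MvPolynomial.WeightedHomogeneous
import HarnessLib

/-!
# Route `DepthWindow`, g8 — weights of path products through the jump matrix

Weight bookkeeping for piece (iv) of the `(2,3)` SLIVER LEMMA (lens-4 NODE-v8 §11): the generic gate
builder `exists_append_sumProdSumProdMul` needs every inner path product of a block to be weighted
homogeneous of a weight depending only on the block's endpoints.  For the jump matrix this holds
with weight = the increment of the degree coordinate:

* `jumpMat_isWeightedHomogeneous`: entry `x → y` of `jumpMat w d t U` has weight `y₁ - x₁`; so has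
  every entry of the identity layers (`one_apply_isWeightedHomogeneous`), hence of the padded layers
  (`padLayers_jumpMat_isWeightedHomogeneous`); entries with `y₁ < x₁` vanish;
* `pathWeight_isWeightedHomogeneous_of_graded`: for ANY layers whose entries are graded this way and
  vanish below the diagonal in the degree coordinate, the weight of a path `s₀ → ⋯ → s_b` is
  homogeneous of weight `(s_b)₁ - (s₀)₁` (monotone paths telescope — `sum_steps_eq_of_stepMono` —
  and non-monotone paths have weight `0`);
* `pathWeight_padLayers_isWeightedHomogeneous`: the instance for the two-level jump formula.

Pure algebra; nothing here bears on `VP ≠ VNP`.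

[cite: LimayeSrinivasanTavenas2025, Lemma 11] [cite: Burgisser2000, Def. 2.1]
-/

set_option linter.dupNamespace false

namespace Summit.ValiantsHypothesis.ValiantsHypothesis.Theorems.DepthWindow

open Finset MvPolynomial

variable {σ R : Type*} [CommRing R]

/-- Entries of the jump matrix are weighted homogeneous of weight `y₁ - x₁`. -/
theorem jumpMat_isWeightedHomogeneous (w : σ → ℕ) (d t : ℕ) (U : ℕ → MvPolynomial σ R)
    (x y : Fin (d + 1) × Fin (t + 1)) :
    IsWeightedHomogeneous w (jumpMat w d t U x y) ((y.1 : ℕ) - x.1) := by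
  rw [jumpMat_apply]
  by_cases hv : (x.2 : ℕ) < y.2 ∧ (x.1 : ℕ) < y.1
  · rw [if_pos hv]
    have h0 : IsWeightedHomogeneous w
        (∏ l ∈ Ico (x.2 : ℕ) ((y.2 : ℕ) - 1), weightedHomogeneousComponent w 0 (U l))
        (∑ l ∈ Ico (x.2 : ℕ) ((y.2 : ℕ) - 1), (0 : ℕ)) :=
      IsWeightedHomogeneous.prod _ _ _ fun l _ => weightedHomogeneousComponent_isWeightedHomogeneous 0 _
    rw [Finset.sum_const_zero] at h0
    simpa using h0.mul (weightedHomogeneousComponent_isWeightedHomogeneous ((y.1 : ℕ) - x.1) (U _))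
  · rw [if_neg hv]
    exact isWeightedHomogeneous_zero R w _

/-- Entries of the jump matrix below the diagonal in the degree coordinate vanish. -/
theorem jumpMat_eq_zero_of_lt (w : σ → ℕ) (d t : ℕ) (U : ℕ → MvPolynomial σ R)
    (x y : Fin (d + 1) × Fin (t + 1)) (h : (y.1 : ℕ) < x.1) : jumpMat w d t U x y = 0 := by
  rw [jumpMat_apply, if_neg (fun hv => by omega)]

/-- Entries of an identity layer are weighted homogeneous of weight `y₁ - x₁`. -/
theorem one_apply_isWeightedHomogeneous (w : σ → ℕ) (d t : ℕ) (x y : Fin (d + 1) × Fin (t + 1)) :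
    IsWeightedHomogeneous w
      ((1 : Matrix (Fin (d + 1) × Fin (t + 1)) (Fin (d + 1) × Fin (t + 1)) (MvPolynomial σ R)) x y)
      ((y.1 : ℕ) - x.1) := by
  by_cases hxy : x = y
  · subst hxy
    rw [Matrix.one_apply_eq, Nat.sub_self]
    exact isWeightedHomogeneous_one R w
  · rw [Matrix.one_apply_ne hxy]
    exact isWeightedHomogeneous_zero R w _

omit [CommRing R] in
/-- Entries of an identity layer below the diagonal vanish. -/
theorem one_apply_eq_zero_of_lt [CommSemiring R] (d t : ℕ) (x y : Fin (d + 1) × Fin (t + 1))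
    (h : (y.1 : ℕ) < x.1) :
    (1 : Matrix (Fin (d + 1) × Fin (t + 1)) (Fin (d + 1) × Fin (t + 1)) (MvPolynomial σ R)) x y = 0 :=
  Matrix.one_apply_ne fun hxy => by subst hxy; omega

/-- Entries of the padded layers are weighted homogeneous of weight `y₁ - x₁`. -/
theorem padLayers_jumpMat_isWeightedHomogeneous (w : σ → ℕ) (d t : ℕ) (U : ℕ → MvPolynomial σ R)
    (κ n : ℕ) (i : Fin n) (x y : Fin (d + 1) × Fin (t + 1)) :
    IsWeightedHomogeneous w (padLayers (jumpMat w d t U) κ n i x y) ((y.1 : ℕ) - x.1) := by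
  unfold padLayers
  by_cases hi : (i : ℕ) < κ
  · simp only [if_pos hi]; exact jumpMat_isWeightedHomogeneous w d t U x y
  · simp only [if_neg hi]; exact one_apply_isWeightedHomogeneous w d t x y

/-- Entries of the padded layers below the diagonal vanish. -/
theorem padLayers_jumpMat_eq_zero_of_lt (w : σ → ℕ) (d t : ℕ) (U : ℕ → MvPolynomial σ R)
    (κ n : ℕ) (i : Fin n) (x y : Fin (d + 1) × Fin (t + 1)) (h : (y.1 : ℕ) < x.1) :
    padLayers (jumpMat w d t U) κ n i x y = 0 := by
  unfold padLayers
  by_cases hi : (i : ℕ) < κ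
  · simp only [if_pos hi]; exact jumpMat_eq_zero_of_lt w d t U x y h
  · simp only [if_neg hi]; exact one_apply_eq_zero_of_lt d t x y h

/-- Telescoping along a stepwise-monotone path. -/
theorem sum_steps_eq_of_stepMono :
    ∀ (b : ℕ) (f : Fin (b + 1) → ℕ), (∀ u : Fin b, f u.castSucc ≤ f u.succ) →
      ∑ u : Fin b, (f u.succ - f u.castSucc) = f (Fin.last b) - f 0
  | 0, f, _ => by simp
  | b + 1, f, hf => by
      rw [Fin.sum_univ_castSucc]
      have ih := sum_steps_eq_of_stepMono b (fun u => f u.castSucc) fun u => by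
        have h1 : (u.succ.castSucc : Fin (b + 2)) = u.castSucc.succ := Fin.ext rfl
        show f u.castSucc.castSucc ≤ f u.succ.castSucc
        rw [h1]; exact hf u.castSucc
      have h0 : (Fin.castSucc (0 : Fin (b + 1)) : Fin (b + 2)) = 0 := rfl
      rw [h0] at ih
      have ih' : ∑ u : Fin b, (f u.castSucc.succ - f u.castSucc.castSucc) =
          f (Fin.last b).castSucc - f 0 := by
        rw [← ih]
        refine Finset.sum_congr rfl fun u _ => ?_
        rw [show (u.castSucc.succ : Fin (b + 2)) = u.succ.castSucc from Fin.ext rfl]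
      rw [ih']
      have hmono : Monotone f := Fin.monotone_iff_le_succ.mpr hf
      have hA : f 0 ≤ f (Fin.last b).castSucc := hmono (Fin.zero_le _)
      have hB : f (Fin.last b).castSucc ≤ f (Fin.last b).succ := hf (Fin.last b)
      have hlast : (Fin.last b).succ = Fin.last (b + 1) := Fin.succ_last b
      rw [hlast] at hB ⊢
      omega

/-- **Path products through graded layers are weighted homogeneous**, of weight = the increment of
the degree coordinate between the endpoints. [cite: LimayeSrinivasanTavenas2025, Lemma 11] -/
theorem pathWeight_isWeightedHomogeneous_of_graded (w : σ → ℕ) {d t b : ℕ}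
    (M : Fin b → Matrix (Fin (d + 1) × Fin (t + 1)) (Fin (d + 1) × Fin (t + 1)) (MvPolynomial σ R))
    (hM : ∀ u x y, IsWeightedHomogeneous w (M u x y) ((y.1 : ℕ) - x.1))
    (hM0 : ∀ u x y, (y.1 : ℕ) < x.1 → M u x y = 0)
    (s : Fin (b + 1) → Fin (d + 1) × Fin (t + 1)) :
    IsWeightedHomogeneous w (pathWeight M s) (((s (Fin.last b)).1 : ℕ) - (s 0).1) := by
  unfold pathWeight
  by_cases hmono : ∀ u : Fin b, ((s u.castSucc).1 : ℕ) ≤ (s u.succ).1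
  · have h := IsWeightedHomogeneous.prod Finset.univ (fun u : Fin b => M u (s u.castSucc) (s u.succ))
      (fun u => ((s u.succ).1 : ℕ) - (s u.castSucc).1) fun u _ => hM u _ _
    rwa [sum_steps_eq_of_stepMono b (fun u => ((s u).1 : ℕ)) hmono] at h
  · simp only [not_forall, not_le] at hmono
    obtain ⟨u, hu⟩ := hmono
    rw [Finset.prod_eq_zero (Finset.mem_univ u) (hM0 u _ _ hu)]
    exact isWeightedHomogeneous_zero R w _

/-- The instance for the two-level jump formula: inner path products of block `q` of the padded
jump layers are weighted homogeneous of weight `(s_b)₁ - (s₀)₁`. -/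
theorem pathWeight_padLayers_isWeightedHomogeneous (w : σ → ℕ) (d t : ℕ) (U : ℕ → MvPolynomial σ R)
    (κ a b : ℕ) (q : Fin a) (s : Fin (b + 1) → Fin (d + 1) × Fin (t + 1)) :
    IsWeightedHomogeneous w
      (pathWeight (fun u : Fin b =>
        padLayers (jumpMat w d t U) κ (a * b) ⟨(q : ℕ) * b + u, blockIndex_lt q u⟩) s)
      (((s (Fin.last b)).1 : ℕ) - (s 0).1) :=
  pathWeight_isWeightedHomogeneous_of_graded w _
    (fun _ x y => padLayers_jumpMat_isWeightedHomogeneous w d t U κ (a * b) _ x y)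
    (fun _ x y h => padLayers_jumpMat_eq_zero_of_lt w d t U κ (a * b) _ x y h) s

end Summit.ValiantsHypothesis.ValiantsHypothesis.Theorems.DepthWindow
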